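import Summits.ABC.IUTFork.Cor312ProvenanceSum
import HarnessLib

/-!
# [IUTchIII] Cor. 3.12 provenance — the `q`-pilot local log-volume from WEIGHTED PIECES: what the weights and the
# centres of an assembled real setting must satisfy for `−|log(q)| = −(1/2l)·log(q)` (c312 crew, wave 2, row W2-F′)

Record-only companion (seat abc-iut-c312-8, gen 2); TAKES NO SIDE on Cor. 3.12. `Cor312ProvenanceSum.lean` reduced the one
quantitative field of the provenance link, `IsSettingOf.negLogQ_eq : P.negLogQ = −absLogq D` ([IUTchIV] kurims p. 23: "the
quantity “`|log(q)|`” defined in [IUTchIII], Corollary 3.12, is equal to `(1/2l)·log(q)`"), to ONE identity per label `j` and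
prime `v_ℚ` (`negLogQ_eq_neg_absLogq_of_local`):
`P.qLocal j v_ℚ = −(Σ_{v ∈ 𝕍(F)^bad, v | v_ℚ} ord_v(q_v)·log N(v)) / (2l·[F:ℚ])`.
abc-iut-c312-6's `Cor312VolumesReal.qLocal_ofComparison` (p410461) computes the left side for the assembled REAL setting
(c312-7's `Setting.ofComparison` over `VolumePieces`) in closed form: `qLocal j v_ℚ = Σ_i w_i · μ̇^log_{K_i}(λ_{q,i})` — a
weighted sum over the field factors `K_i` of the completed tensor packet at `(j, v_ℚ)` ([IUTchIII] Rmk. 3.1.1 (ii)–(iii)) of the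
log-moduli of the components of the `q`-pilot's centre `λ_q`; and S1's `mulLogVolume_eq_mul_log_norm` reads
`μ̇^log_{K_i}(λ) = [K_i:ℚ_{v_ℚ}]·log ‖λ‖` ([AbsTopIII] Prop. 5.7 (i)(b)).

THIS FILE supplies the remaining ARITHMETIC, abstractly over any finite family of pieces `i` at `(j, v_ℚ)`, each lying over
a place `π i` of `F` over `v_ℚ`, with "weight × degree" `wd_i` (`= w_i·[K_i:ℚ_{v_ℚ}]`) and "log-norm of the centre" `n_i`
(`= log ‖λ_{q,i}‖`):
* `sum_pieces_eq_neg_qFiber` — IF (marginals) for every bad `v | v_ℚ` the pieces over `v` have `Σ_{i over v} wd_i = Pr(v)/[F:ℚ]`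
  for some nonzero `Pr(v)` (take `Pr(v) := [F_v:ℚ_p]`, so that `Pr(v)/[F:ℚ]` IS Dupuy–Hilado's normalised weight — the
  normalisation of [IUTchIII] Rmk. 3.1.1 (ii); clarity note N-w5d188-2 —, c312-6's
  `verbatim_weight_eq_dh_weight`; any nonzero `Pr` works since it cancels), (centres) over a bad `v` the centre has
  `n_i = −ord_v(q_v)·log N(v)/(2l·Pr(v))` (i.e. `[F_v:ℚ_p]·log‖q̲_v‖ = −(1/2l)·ord_v(q_v)·log N(v)`: the centre is a `2l`-th ROOT
  `q̲_v` of the `q`-parameter, [IUTchI] Ex. 3.2 (iv), abc-iut-L6-t24 R7-C5-F1b) and over a good `v` it is a unit (`n_i = 0`),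
  THEN `Σ_i wd_i·n_i = −(Σ_{v bad, v | v_ℚ} ord_v(q_v)·log N(v))/(2l·[F:ℚ])` — PROVED (regrouping along `π`);
* **`negLogQ_eq_neg_absLogq_of_pieces`** — hence, for a Cor. 3.12 setting `P` whose local `q`-volumes ARE such weighted sums
  (`hq`, = c312-6's closed form), `P.negLogQ = −absLogq D`: the provenance link's quantitative field, DISCHARGED modulo the
  three named properties of the assembler's weights and centres — which is also the precise form of the normalisation the
  assembler must choose (finding N-C8-1, `Cor312ProvenanceScale.lean`: an un-normalized choice makes `IsSettingOf` unsatisfiable).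
Deliberately NOT here: the `VolumePieces` instance itself (c312-7-successor / c312-5 / c312-3), the `𝕍 ≅ 𝕍_mod`-indexed variant
(pieces over places of `F_mod`; needs the per-prime base change `Σ_{v|w} e_v f_v = [F:F_mod]`, on request).
[claim: Mochizuki2012, status: disputed] for every quotation.
-/

noncomputable section

namespace Summit.ABC.IUTFork.Cor312Prov

open Literature.IUT.HodgeTheaters Literature.IUT.LogVolume NumberField IsDedekindDomain
open scoped Classical

universe u v w

variable {F : Type u} {K : Type v} {Fbar : Type w} [Field F] [NumberField F] [Field K] [NumberField K]
  [Algebra F K] [Field Fbar] [Algebra F Fbar] [Algebra K Fbar] {E : WeierstrassCurve F} [E.IsElliptic]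
  {l : ℕ} {Pb : BadPlacePredicates K}

/-- **Weighted pieces over the places of one fibre sum to the fibre's `q`-term.** Pieces `i : I` at a prime `k` (`hπ`: each
lies over a place `π i` of `F` with `g (π i) = k`), "weight × degree" `wd i` and "log-norm of the `q`-centre" `n i`: if over
every bad place `v` of the fibre the `wd` add up to `Pr(v)/[F:ℚ]` (`hmarg`, `Pr(v) ≠ 0`), over a bad `v` the centre's log-norm is
`−ord_v(q_v)·log N(v)/(2l·Pr(v))` (`hbad`; `qTerm v = ord_v(q_v)·log N(v)`) and over a good `v` it vanishes (`hgood`), then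
`Σ_i wd_i·n_i = −(Σ_{v ∈ 𝕍(F)^bad, g v = k} qTerm v)/(2l·[F:ℚ])` — [IUTchIII] Prop. 3.9 (iii) / [IUTchIV] p. 23 local content
of "`|log(q)| = (1/2l)·log(q)`", with [IUTchIII] Rmk. 3.1.1 (ii) weights. PROVED (pure regrouping).
[claim: Mochizuki2012, status: disputed] -/
theorem sum_pieces_eq_neg_qFiber (D : InitialThetaData F K Fbar E l Pb) {κ : Type*} [DecidableEq κ]
    (g : FinitePlace F → κ) (k : κ) {I : Type*} [Fintype I] (π : I → FinitePlace F) (hπ : ∀ i, g (π i) = k)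
    (wd n : I → ℝ) (Pr : FinitePlace F → ℝ) (hPr : ∀ v ∈ D.VFbad, Pr v ≠ 0)
    (hmarg : ∀ v ∈ D.VFbad, g v = k →
      ∑ i ∈ Finset.univ.filter (fun i => π i = v), wd i = Pr v / Module.finrank ℚ F)
    (hbad : ∀ i, π i ∈ D.VFbad → n i = -(qTerm (E := E) (π i)) / (2 * (l : ℝ) * Pr (π i)))
    (hgood : ∀ i, π i ∉ D.VFbad → n i = 0) :
    ∑ i, wd i * n i =
      -(∑ v ∈ (vFbad_finite D).toFinset with g v = k, qTerm (E := E) v) / (2 * (l : ℝ) * Module.finrank ℚ F) := by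
  set B := (vFbad_finite D).toFinset.filter (fun v => g v = k) with hB
  -- pieces over good places contribute nothing
  have hsplit : ∑ i, wd i * n i = ∑ i ∈ Finset.univ.filter (fun i => π i ∈ D.VFbad), wd i * n i := by
    rw [← Finset.sum_filter_add_sum_filter_not Finset.univ (fun i => π i ∈ D.VFbad)]
    have h0 : ∑ i ∈ Finset.univ.filter (fun i => ¬ π i ∈ D.VFbad), wd i * n i = 0 :=
      Finset.sum_eq_zero fun i hi => by
        rw [Finset.mem_filter] at hi
        rw [hgood i hi.2, mul_zero]
    rw [h0, add_zero]
  rw [hsplit]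
  -- regroup the bad pieces along `π` over the bad places of the fibre
  have hmaps : ∀ i ∈ Finset.univ.filter (fun i => π i ∈ D.VFbad), π i ∈ B := fun i hi => by
    rw [Finset.mem_filter] at hi
    exact Finset.mem_filter.mpr ⟨(vFbad_finite D).mem_toFinset.mpr hi.2, hπ i⟩
  rw [← Finset.sum_fiberwise_of_maps_to hmaps]
  have hterm : ∀ v ∈ B,
      ∑ i ∈ (Finset.univ.filter (fun i => π i ∈ D.VFbad)).filter (fun i => π i = v), wd i * n i =
        -(qTerm (E := E) v) / (2 * (l : ℝ) * Module.finrank ℚ F) := by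
    intro v hv
    obtain ⟨hvbad', hgk⟩ := Finset.mem_filter.mp hv
    have hvbad : v ∈ D.VFbad := (vFbad_finite D).mem_toFinset.mp hvbad'
    have hfilt : (Finset.univ.filter (fun i => π i ∈ D.VFbad)).filter (fun i => π i = v) =
        Finset.univ.filter (fun i => π i = v) := by
      ext i
      simp only [Finset.mem_filter, Finset.mem_univ, true_and]
      exact ⟨fun h => h.2, fun h => ⟨h ▸ hvbad, h⟩⟩
    rw [hfilt]
    have hn : ∀ i ∈ Finset.univ.filter (fun i => π i = v),
        wd i * n i = wd i * (-(qTerm (E := E) v) / (2 * (l : ℝ) * Pr v)) := by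
      intro i hi
      rw [Finset.mem_filter] at hi
      rw [hbad i (hi.2 ▸ hvbad), hi.2]
    rw [Finset.sum_congr rfl hn, ← Finset.sum_mul, hmarg v hvbad hgk]
    have hP := hPr v hvbad
    have hF : (Module.finrank ℚ F : ℝ) ≠ 0 := FinDivisor.finrank_pos.ne'
    field_simp
  rw [Finset.sum_congr rfl hterm, ← Finset.sum_div, Finset.sum_neg_distrib]

/-- **`−|log(q)| = −(1/2l)·log(q)` for a setting whose local `q`-volumes are weighted piece-sums** — the provenance link's
quantitative field DISCHARGED modulo three named properties of the assembler's data. For a Cor. 3.12 setting `P` (c312-7) over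
an index skeleton `T`, a "place of `ℚ` below" map `g`, and at every `(j, v_ℚ)` a finite family of pieces `I j v_ℚ` (the field
factors `K_i` of the completed tensor packet, [IUTchIII] Rmk. 3.1.1 (iii); c312-6's `VolumePieces.J`) lying over places
`π` of `F` over `v_ℚ`, with `P.qLocal j v_ℚ = Σ_i wd_i·n_i` (`hq`: c312-6's `qLocal_ofComparison` + S1's
`mulLogVolume_eq_mul_log_norm`, `wd_i = w_i·[K_i:ℚ_{v_ℚ}]`, `n_i = log‖λ_{q,i}‖`), weights with the Rmk. 3.1.1 (ii)
marginals (`hmarg`), centres `= 2l`-th roots of the `q`-parameters at the bad places and units elsewhere (`hbad`, `hgood`):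
`P.negLogQ = −absLogq D`. PROVED (`sum_pieces_eq_neg_qFiber` + `negLogQ_eq_neg_absLogq_of_local`). With c312-5's real index this
gives `IsSettingOf D P` (`isSettingOf_ofInitial`). [claim: Mochizuki2012, status: disputed] -/
theorem negLogQ_eq_neg_absLogq_of_pieces (D : InitialThetaData F K Fbar E l Pb) {T : Thm311.ThetaIndex}
    [DecidableEq T.VQ] {S : Thm311.Situation T} (P : Cor312.Setting S) (g : FinitePlace F → T.VQ)
    (Pr : FinitePlace F → ℝ) (hPr : ∀ v ∈ D.VFbad, Pr v ≠ 0)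
    (I : Fin T.lstar → T.VQ → Type*) [∀ i vQ, Fintype (I i vQ)]
    (π : ∀ i vQ, I i vQ → FinitePlace F) (hπ : ∀ i vQ x, g (π i vQ x) = vQ)
    (wd n : ∀ i vQ, I i vQ → ℝ)
    (hmarg : ∀ i vQ, ∀ v ∈ D.VFbad, g v = vQ →
      ∑ x ∈ Finset.univ.filter (fun x => π i vQ x = v), wd i vQ x = Pr v / Module.finrank ℚ F)
    (hbad : ∀ i vQ x, π i vQ x ∈ D.VFbad →
      n i vQ x = -(qTerm (E := E) (π i vQ x)) / (2 * (l : ℝ) * Pr (π i vQ x)))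
    (hgood : ∀ i vQ x, π i vQ x ∉ D.VFbad → n i vQ x = 0)
    (hq : ∀ i vQ, P.qLocal (Cor312.Setting.labelSucc i) vQ = ∑ x, wd i vQ x * n i vQ x) :
    P.negLogQ = -absLogq D :=
  negLogQ_eq_neg_absLogq_of_local D P g fun i vQ => by
    rw [hq i vQ]
    exact sum_pieces_eq_neg_qFiber D g vQ (π i vQ) (hπ i vQ) (wd i vQ) (n i vQ) Pr hPr (hmarg i vQ)
      (hbad i vQ) (hgood i vQ)

end Summit.ABC.IUTFork.Cor312Prov

end
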